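import Literature.Computability.AlgebraicComplexity.PencilRankNonSplitDivisor
import Literature.Computability.AlgebraicComplexity.PencilRankDiagonalizablePerturbation
import Mathlib.LinearAlgebra.Matrix.Kronecker
import HarnessLib

/-!
# The real Jordan block `C_k(c,s) + J_k ⊗ E₂` has pencil rank `≥ 2k + 1`
# (Sumi–Miyazaki–Sakata 2009, Lemma 9 / Thm. 20 — the lower half, every field)

Topic `Literature/Computability/AlgebraicComplexity` (bilinear complexity; rank of matrix pencils).
Sequel to `PencilRankNonSplitDivisor.lean` (`succ_natDegree_mul_card_le_natDegree_mul_tensorRank`: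
`(d+1)m ≤ d·R(XI + YA)` when a rootless degree-`d` polynomial annihilates `A`). Source: T. Sumi,
M. Miyazaki, T. Sakata, *Rank of 3-tensors with 2 slices and Kronecker canonical forms*, LAA 431
(2009), arXiv:0808.1167 (held text `paper:arxiv-0808.1167`, read 2026-08-27): Lemma 1 type (C)
"`2k × 2k × 2` tensor `(C_k(c,s) + J_k ⊗ E₂; E_{2k})`, `s ≠ 0`" (the real Kronecker block of a
non-real eigenvalue pair), Lemma 9 ("there is a tensor `T'` with rank at most `1` such that
`T − T'` is diagonalizable. In particular, `rank_𝔽(T) ≤ ℓ + 1`.") and Thm. 20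
("`rank_𝔽(E_n;A) = n + max_x α_𝔽(A,x)`, where we treat `C_k(c,s) + J_k ⊗ E₂` as a Jordan block of
size `2k` if `𝔽 = ℝ`").

## What is proved

* **`succ_two_mul_le_tensorRank_realJordanBlock`** — over every field `K` and for all `c, s` with
  `(β − c)² + s² ≠ 0` for every `β ∈ K` (e.g. `K = ℝ`, `s ≠ 0`):
  `2k + 1 ≤ R(XI_{2k} + Y·(I_k ⊗ (c −s; s c) + J_{k,0} ⊗ I₂))` (`k ≥ 1`). Proof: the polynomial
  `((T − c)² + s²)^k` is rootless of degree `2k` and annihilates the block, because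
  `(A − c)² + s² = N(2S + N)` with `N = J_{k,0} ⊗ I₂` nilpotent (`N^k = 0`) commuting with
  `S = I_k ⊗ (0 −s; s 0)`, `S² = −s²`.

* `tensorRank_pencilTensor_one_rotationBlock` — the case `k = 1` in full over every such field:
  `R(XI₂ + Y·(c −s; s c)) = 3` (upper bound by the rank-one diagonalizable perturbation
  `P·diag(c, c+1)·P⁻¹`, `P = (1 0; −s 1)`, via `tensorRank_pencilTensor_one_le_card_add_rank_sub`).

Not typed: the upper bound `≤ 2k + 1` for `k ≥ 2` (Lemma 9 via a cyclic vector / Cor. 8 there; it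
needs `(T − c)² + s²` separable — automatic for `𝔽 = ℝ`).
Theorem-only file: no definitions, no named facts.

## References

* [SumiMiyazakiSakata2008] T. Sumi, M. Miyazaki, T. Sakata, LAA 431 (2009) 1858–1868,
  arXiv:0808.1167 — Lemma 1 (C), Lemma 9, Thm. 20 (pp. 4, 7 of the arXiv text).
-/

noncomputable section

open scoped BigOperators
open Module Finset Matrix

namespace Literature.Computability.AlgebraicComplexity

namespace MatrixPencil

section PartTwentySeven

universe u27

variable {K : Type u27} [Field K]

open scoped Kronecker

/-! ### The real Jordan block `C_k(c,s) + J_k ⊗ E₂`: `R ≥ 2k + 1` when `(T − c)² + s²` has no root -/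

/-- Powers of the nilpotent Jordan block: `(J_{k,0}^p)_{ij} = [j = i + p]`. [folklore] -/
private theorem jordanBlock_zero_pow_apply (k p : ℕ) (i j : Fin k) :
    (jordanBlock k (0 : K) ^ p) i j = if (j : ℕ) = i + p then 1 else 0 := by
  induction p generalizing i j with
  | zero =>
    rw [pow_zero, Matrix.one_apply]
    by_cases h : i = j
    · subst h; simp
    · have h' : (j : ℕ) ≠ i + 0 := fun e => h (Fin.ext (by omega))
      rw [if_neg h, if_neg h']
  | succ p ih =>
    rw [pow_succ, Matrix.mul_apply]
    have hJ : ∀ l : Fin k, jordanBlock k (0 : K) l j = if (j : ℕ) = l + 1 then 1 else 0 := fun l => by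
      simp only [jordanBlock, Matrix.of_apply]
      by_cases hl : l = j
      · subst hl
        have : (l : ℕ) ≠ l + 1 := by omega
        rw [if_pos rfl, if_neg this]
      · rw [if_neg hl]
    simp only [ih, hJ]
    by_cases hij : (j : ℕ) = i + (p + 1)
    · rw [if_pos hij]
      have hl : i.1 + p < k := by omega
      rw [Finset.sum_eq_single ⟨i.1 + p, hl⟩]
      · have e1 : ((⟨i.1 + p, hl⟩ : Fin k) : ℕ) = i + p := rfl
        rw [if_pos e1, if_pos (show (j : ℕ) = ((⟨i.1 + p, hl⟩ : Fin k) : ℕ) + 1 by rw [e1]; omega),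
          one_mul]
      · intro l _ hne
        have : ¬ ((l : ℕ) = i + p) := fun e => hne (Fin.ext (by simpa using e))
        rw [if_neg this, zero_mul]
      · exact fun h => absurd (Finset.mem_univ _) h
    · rw [if_neg hij]
      refine Finset.sum_eq_zero fun l _ => ?_
      by_cases h1 : (l : ℕ) = i + p
      · have h2 : ¬ ((j : ℕ) = l + 1) := fun e => hij (by omega)
        rw [if_pos h1, if_neg h2, mul_zero]
      · rw [if_neg h1, zero_mul]

/-- `J_{k,0}^k = 0`. [folklore] -/
private theorem jordanBlock_zero_pow_self (k : ℕ) : jordanBlock k (0 : K) ^ k = 0 := by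
  ext i j
  rw [jordanBlock_zero_pow_apply, Matrix.zero_apply]
  have : ¬ ((j : ℕ) = i + k) := fun e => by have := j.2; omega
  rw [if_neg this]

/-- **`R(E_{2k}; C_k(c,s) + J_k ⊗ E₂) ≥ 2k + 1` whenever `(T − c)² + s²` has no root in `K`**
(e.g. `K = ℝ`, `s ≠ 0`): the real Jordan block of a non-real eigenvalue pair counts like a Jordan
block of size `2k` — the lower half of its rank `2k + 1` ([SumiMiyazakiSakata2008, Lemma 9 and
Thm. 20: "we treat `C_k(c,s) + J_k ⊗ E₂` as a Jordan block of size `2k` if `𝔽 = ℝ`"]). Here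
`C_k(c,s) + J_k ⊗ E₂ = I_k ⊗ (c −s; s c) + J_{k,0} ⊗ I₂`; proof by
`succ_natDegree_mul_card_le_natDegree_mul_tensorRank` with `p = ((T − c)² + s²)^k`, which
annihilates the block (`(A − c)² + s² = N(2S + N)` with `N = J ⊗ I₂` nilpotent commuting with
`S = I ⊗ (0 −s; s 0)`). The upper bound `≤ 2k + 1` (cyclic vector, Cor. 8 there) is not typed.
[cite: SumiMiyazakiSakata2008, Lemma 9 and Thm. 20] -/
theorem succ_two_mul_le_tensorRank_realJordanBlock (k : ℕ) (hk : 1 ≤ k) (c s : K)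
    (hq : ∀ β : K, (β - c) ^ 2 + s ^ 2 ≠ 0) :
    2 * k + 1 ≤ tensorRank (pencilTensor (1 : Matrix (Fin k × Fin 2) (Fin k × Fin 2) K)
      ((1 : Matrix (Fin k) (Fin k) K) ⊗ₖ !![c, -s; s, c] +
        jordanBlock k (0 : K) ⊗ₖ (1 : Matrix (Fin 2) (Fin 2) K))) := by
  classical
  set C : Matrix (Fin 2) (Fin 2) K := !![c, -s; s, c] with hC
  set J := jordanBlock k (0 : K) with hJ
  set A := (1 : Matrix (Fin k) (Fin k) K) ⊗ₖ C + J ⊗ₖ (1 : Matrix (Fin 2) (Fin 2) K) with hA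
  set C' : Matrix (Fin 2) (Fin 2) K := !![0, -s; s, 0] with hC'
  set S := (1 : Matrix (Fin k) (Fin k) K) ⊗ₖ C' with hS
  set N := J ⊗ₖ (1 : Matrix (Fin 2) (Fin 2) K) with hN
  -- structure: `A − c = S + N`, `S N = N S`, `S² = −s²`, `N^k = 0`
  have hAc : A - c • (1 : Matrix (Fin k × Fin 2) (Fin k × Fin 2) K) = S + N := by
    ext ⟨i, a⟩ ⟨j, b⟩
    simp only [hA, hS, hN, hC, hC', Matrix.sub_apply, Matrix.add_apply, Matrix.kroneckerMap_apply,
      Matrix.smul_apply, Matrix.one_apply, smul_eq_mul]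
    fin_cases a <;> fin_cases b <;> by_cases hij : i = j <;> simp [hij]
  have hSN : S * N = N * S := by
    rw [hS, hN, ← Matrix.mul_kronecker_mul, ← Matrix.mul_kronecker_mul, Matrix.one_mul, Matrix.mul_one,
      Matrix.one_mul, Matrix.mul_one]
  have hSS : S * S = -(s ^ 2) • (1 : Matrix (Fin k × Fin 2) (Fin k × Fin 2) K) := by
    have hC2 : C' * C' = -(s ^ 2) • (1 : Matrix (Fin 2) (Fin 2) K) := by
      ext a b
      fin_cases a <;> fin_cases b <;> simp [hC', Matrix.mul_apply, Fin.sum_univ_two] <;> ring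
    rw [hS, ← Matrix.mul_kronecker_mul, Matrix.one_mul, hC2, Matrix.kronecker_smul,
      Matrix.one_kronecker_one]
  have hNk : N ^ k = 0 := by
    have hpow : ∀ p : ℕ, N ^ p = (J ^ p) ⊗ₖ (1 : Matrix (Fin 2) (Fin 2) K) := by
      intro p
      induction p with
      | zero => rw [pow_zero, pow_zero, Matrix.one_kronecker_one]
      | succ p ih => rw [pow_succ, ih, hN, ← Matrix.mul_kronecker_mul, Matrix.one_mul, ← pow_succ]
    rw [hpow, hJ, jordanBlock_zero_pow_self, Matrix.zero_kronecker]
  -- the annihilating polynomial `p = ((T − c)² + s²)^k`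
  set q : Polynomial K := (Polynomial.X - Polynomial.C c) ^ 2 + Polynomial.C (s ^ 2) with hqd
  have hq2 : q.natDegree = 2 := by
    rw [hqd, Polynomial.natDegree_add_C, Polynomial.natDegree_pow, Polynomial.natDegree_X_sub_C]
  have haq : Polynomial.aeval A q = N * ((2 : K) • S + N) := by
    have h1 : Polynomial.aeval A q = (A - c • 1) * (A - c • 1) + (s ^ 2) • (1 : Matrix _ _ K) := by
      rw [hqd, map_add, map_pow, map_sub, Polynomial.aeval_X, Polynomial.aeval_C, Polynomial.aeval_C,
        Algebra.algebraMap_eq_smul_one, Algebra.algebraMap_eq_smul_one, pow_two]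
    rw [h1, hAc, add_mul, mul_add, mul_add, hSS, hSN, Matrix.mul_add, Matrix.mul_smul, two_smul,
      neg_smul]
    abel
  have hp0 : Polynomial.aeval A (q ^ k) = 0 := by
    rw [map_pow, haq]
    have hcomm : Commute N ((2 : K) • S + N) := by
      refine Commute.add_right (Commute.smul_right ?_ _) (Commute.refl N)
      exact hSN.symm
    rw [hcomm.mul_pow, hNk, zero_mul]
  have hroot : ∀ β : K, (q ^ k).eval β ≠ 0 := fun β => by
    rw [Polynomial.eval_pow]
    refine pow_ne_zero _ ?_
    simpa [hqd] using hq β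
  have h := succ_natDegree_mul_card_le_natDegree_mul_tensorRank A (q ^ k) hp0 hroot
  rw [Polynomial.natDegree_pow, hq2, Fintype.card_prod, Fintype.card_fin, Fintype.card_fin] at h
  -- `(2k+1)(2k) ≤ 2k · R`
  have h' : 2 * k * (2 * k + 1) ≤ 2 * k * tensorRank (pencilTensor (1 : Matrix (Fin k × Fin 2) (Fin k × Fin 2) K) A) := by
    have e1 : 2 * k * (2 * k + 1) = (k * 2 + 1) * (k * 2) := by ring
    have e2 : k * 2 * tensorRank (pencilTensor (1 : Matrix (Fin k × Fin 2) (Fin k × Fin 2) K) A) =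
        2 * k * tensorRank (pencilTensor (1 : Matrix (Fin k × Fin 2) (Fin k × Fin 2) K) A) := by ring
    rw [e1, ← e2]
    exact h
  exact Nat.le_of_mul_le_mul_left h' (by omega)

end PartTwentySeven

section PartThirtyOne

universe u31

variable {K : Type u31} [Field K]

/-! ### `k = 1`: `R(E₂; C(c,s)) = 3` exactly, over every field in which `(T − c)² + s²` is rootless -/

/-- **`R(XI₂ + Y·(c −s; s c)) = 3`** whenever `(T − c)² + s²` has no root in `K` (every field; `ℝ`
with `s ≠ 0`) — [SumiMiyazakiSakata2008, Lemma 9] for the type-(C) block with `k = 1`, in full: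
lower bound `succ_two_mul_le_tensorRank_realJordanBlock`-style via the rootless annihilator
`(T − c)² + s²`, upper bound by the rank-one diagonalizable perturbation
`D = P·diag(c, c+1)·P⁻¹`, `P = (1 0; −s 1)`, `C(c,s) − D = (0 −s; 0 −1)` of rank `1`
(`tensorRank_pencilTensor_one_le_card_add_rank_sub`). [cite: SumiMiyazakiSakata2008, Lemma 9 (type (C), `k = 1`) and Lemma 4] -/
theorem tensorRank_pencilTensor_one_rotationBlock (c s : K) (hq : ∀ β : K, (β - c) ^ 2 + s ^ 2 ≠ 0) :
    tensorRank (pencilTensor (1 : Matrix (Fin 2) (Fin 2) K) !![c, -s; s, c]) = 3 := by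
  classical
  set A : Matrix (Fin 2) (Fin 2) K := !![c, -s; s, c] with hA
  refine le_antisymm ?_ ?_
  · -- upper bound: `A − P diag(c, c+1) P⁻¹` has rank `1`
    set P : Matrix (Fin 2) (Fin 2) K := !![1, 0; -s, 1] with hP
    set d : Fin 2 → K := ![c, c + 1] with hd
    have hPdet : P.det = 1 := by simp [hP, Matrix.det_fin_two]
    have hPunit : IsUnit P.det := by rw [hPdet]; exact isUnit_one
    have hPinv : P⁻¹ = !![1, 0; s, 1] := by
      rw [Matrix.inv_def, hPdet, Ring.inverse_one, one_smul]
      ext i j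
      fin_cases i <;> fin_cases j <;> simp [hP, Matrix.adjugate_fin_two]
    have hdiag : diagonal d = !![c, 0; 0, c + 1] := by
      ext i j
      fin_cases i <;> fin_cases j <;> simp [hd]
    have hdiff : A - P * diagonal d * P⁻¹ = vecMulVec ![-s, -1] ![0, 1] := by
      rw [hPinv, hdiag]
      ext i j
      fin_cases i <;> fin_cases j
      all_goals simp [hA, hP, vecMulVec_apply]
      all_goals ring
    have h := tensorRank_pencilTensor_one_le_card_add_rank_sub A P d hPunit
    rw [hdiff, Fintype.card_fin] at h
    have h1 := Matrix.rank_vecMulVec_le (![-s, -1] : Fin 2 → K) (![0, 1] : Fin 2 → K)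
    omega
  · -- lower bound: `(T − c)² + s²` is a rootless annihilator of degree `2`
    set q : Polynomial K := (Polynomial.X - Polynomial.C c) ^ 2 + Polynomial.C (s ^ 2) with hqd
    have hq2 : q.natDegree = 2 := by
      rw [hqd, Polynomial.natDegree_add_C, Polynomial.natDegree_pow, Polynomial.natDegree_X_sub_C]
    have hp0 : Polynomial.aeval A q = 0 := by
      rw [hqd, map_add, map_pow, map_sub, Polynomial.aeval_X, Polynomial.aeval_C, Polynomial.aeval_C,
        Algebra.algebraMap_eq_smul_one, Algebra.algebraMap_eq_smul_one, pow_two]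
      ext i j
      fin_cases i <;> fin_cases j <;>
        simp [hA, Matrix.mul_apply, Fin.sum_univ_two, Matrix.one_apply] <;> ring
    have hroot : ∀ β : K, q.eval β ≠ 0 := fun β => by simpa [hqd] using hq β
    have h := succ_natDegree_mul_card_le_natDegree_mul_tensorRank A q hp0 hroot
    rw [hq2, Fintype.card_fin] at h
    omega

end PartThirtyOne

end MatrixPencil

end Literature.Computability.AlgebraicComplexity

end
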